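import Literature.NumberTheory.LFunctions.RodgersTaoEnergy
import HarnessLib

/-!
# Rodgers–Tao, §8 in the corrected (arXiv v5, 2021) form: the good interval and the energy
propagation inequality with boundary term

Trunk T-ANT (`Literature/NumberTheory/LFunctions`). Third decomposition file (definitions and
hypothesis predicates; no named facts) for the discharge of
`Literature.NumberTheory.LFunctions.rodgers_tao` /
`Literature.NumberTheory.LFunctions.rodgers_tao_picket_fence` (B. Rodgers, T. Tao, *The de
Bruijn–Newman constant is non-negative*, Forum Math. Pi 8 (2020), e6 = arXiv:1801.05914).

## Why this file exists (a correction in the source)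

`RodgersTaoEnergy.lean` vendored §8 of the paper from the text of arXiv versions 1–4 (= the
journal version): Prop. 8.1 (energy bound at time zero,
`Literature.NumberTheory.LFunctions.rodgers_tao_energy_bound_zero`) and the energy propagation
inequality Prop. 8.2 (`Literature.NumberTheory.LFunctions.rodgers_tao_energy_propagation`), and
`RodgersTaoEnergyProofs.lean` proved Prop. 8.1 from Thm. 7.2 and that Prop. 8.2. In arXiv **v5**
(3 July 2021, "Published version, with corrections to Section 8 to address issues raised by Ofer
Zeitouni regarding treatment of boundary contributions to energy") the authors withdrew the printed
proof of the old Prop. 8.2 — it bounded the cross term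
`Σ_{k ≠ k' ∈ K, j ∉ K} 4 / ((x_k − x_{k'})² (x_k − x_j)(x_{k'} − x_j))` by `Õ(1)`, which does not
follow since the factors `1/(x_k − x_{k'})²` inside `K` are not controlled — and replaced §8 by:

> **Proposition 8.2 (v5)** (Locating a good interval). Let `T` be large. Then there exists an
> interval `I⁰ = [I⁰₋, I⁰₊]_{ℤ*}` containing `[0.9 T log T, 2.1 T log T]_{ℤ*}` and contained in
> `[0.8 T log T, 2.2 T log T]_{ℤ*}` such that
> `∫_{Λ/4}^0 Σ_± Σ_{1 ≤ 2ⁿ ≤ 0.1 T log T} 2⁻ⁿ Ẽ^{[I⁰_± − 2ⁿ, I⁰_± + 2ⁿ]_{ℤ*}}(t) dt = Õ(1)`.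
>
> **Proposition 8.3 (v5)** (Energy propagation inequality). Let `T` be large, let
> `I = [I₁, I₂]_{ℤ*} ⊇ [T log T, 2T log T]_{ℤ*}`, `I ⊆ [0.5 T log T, 3T log T]_{ℤ*}`, let `I⁰` be as
> in Proposition 8.2, and let `Λ/4 ≤ t₁ ≤ t₂ ≤ 0` with `t₂ ≤ t₁ + 1/(100 log² T)`. Then
> `Ẽ^{I'}(t₂) ≤ Ẽ^{I}(t₁) + Õ(1 + |I₁ − I⁰₋| + |I₂ − I⁰₊|)`, `I' = [I₁ + log³ T, I₂ − log³ T]_{ℤ*}`,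

(`Õ(1) = O(log^{O(1)} T)`), Prop. 8.1 being then obtained by choosing a good starting time by
Thm. 7.2, starting from `I⁰`, and applying Prop. 8.3 `O(log² T)` times. The numbering and text of
§§1–7 and §9 are unchanged in v5. This file states the v5 statements (as definitions and
hypothesis predicates, see below); the companion `RodgersTaoEnergyV5Proofs.lean` proves Prop. 8.2
(v5) from Thm. 7.2 and re-proves Prop. 8.1 from the v5 statements, so that the tree's assembly of
Thm. 1.1 no longer needs the withdrawn Prop. 8.2 (the old fact `rodgers_tao_energy_propagation`
is left in place, D-0014, but should not be relied upon: its printed proof is withdrawn).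

## Contents

* `Literature.NumberTheory.LFunctions.dyadicScales T` — the finite set of `n : ℕ` with
  `2ⁿ ≤ T log T / 10` (the range "`1 ≤ 2ⁿ ≤ 0.1 T log T`" of Prop. 8.2 (v5));
* `Literature.NumberTheory.LFunctions.boundaryEnergy T I₁ I₂ t` — the dyadic boundary energy
  `Σ_± Σ_{n} 2⁻ⁿ Ẽ^{[I_± − 2ⁿ, I_± + 2ⁿ]}(t)` of Prop. 8.2 (v5);
* `Literature.NumberTheory.LFunctions.IsGoodInterval t₀ T I₁ I₂ B` — "`I⁰ = [I₁, I₂]` is good at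
  level `B`": the boundary energy is integrable on `[t₀/4, 0]` with integral `≤ B`;
* the two statements of the corrected §8 as HYPOTHESIS PREDICATES in the witness `t₀` of `Λ < 0`
  (`Λ ≤ t₀ < 0`): `Literature.NumberTheory.LFunctions.GoodIntervalBound t₀` (the conclusion of
  Prop. 8.2 (v5), integer-endpoint form) and
  `Literature.NumberTheory.LFunctions.EnergyPropagationV5 t₀` (the conclusion of Prop. 8.3 (v5)).
  They are predicates with an explicit parameter, taken as hypotheses
  `(h : ∀ t₀ < 0, HasOnlyRealZeros (deBruijnH t₀) → EnergyPropagationV5 t₀)` by the theorems of the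
  companion file, and are deliberately NOT registered as closed named facts (D-0026: this file
  comes from a proving seat, which may not add unproved named facts; `GoodIntervalBound` is in any
  case proved there from Thm. 7.2). A seat entitled to do so may later vendor
  `def rodgers_tao_energy_propagation_v5 : Prop := ∀ t₀ < 0, HasOnlyRealZeros (deBruijnH t₀) →
  EnergyPropagationV5 t₀` [RodgersTaoFMP2020, arXiv v5 Prop. 8.3] as the leaf replacing
  `rodgers_tao_energy_propagation`, or discharge it directly from §§2–7;
* the regularity inputs of §8 are likewise taken as explicit hypotheses by the companion file, in
  the forms `∀ t ∈ (t₀, 0], StrictMono (j ↦ x_{j+1}(t))` (§1.2: `0 < x₁(t) < x₂(t) < ⋯`, after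
  Csordas–Smith–Varga) and `∀ j, ContinuousOn (t ↦ x_{j+1}(t)) (t₀, 0]` (Thm. 4.1);
* small API: `mem_dyadicScales`, `boundaryEnergy_nonneg`, `renormEnergy_nonneg_of_strictMono`,
  `renormEnergyOn_mono_of_strictMono`, `continuousAt_renormPotential`.

## Conventions (as in `RodgersTao.lean`, `RodgersTaoEnergy.lean`)

* The standing hypothesis `Λ < 0` is carried by a witness: `t₀ < 0` with `H_{t₀}` having only real
  zeros (so `Λ ≤ t₀ < 0`). Every statement of the paper involving `Λ` is vendored with `Λ`
  replaced by such a witness `t₀` (`Λ/4 ≤ t` becomes `t₀/4 ≤ t`, `Λ < t ≤ 0` becomes `t₀ < t ≤ 0`):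
  the printed proofs use no property of `Λ` other than `Λ < 0` and "the zeros of `H_t` are real
  and simple for `Λ < t ≤ 0`", which hold verbatim for `t₀` in place of `Λ`.
* Discrete intervals `[a, b]_{ℤ*}` of positive indices are `Finset.Icc ⌈a⌉₊ ⌊b⌋₊` (natural-number
  endpoints where the source produces integers), `x_j(t)` is `deBruijnZero t j` (`j ≥ 1`),
  `Ẽ^I(t)` is `renormEnergyOn t I`, and "`Õ(1)`" is `C log^A T` for constants `A`, `C`.
* The decimal constants `0.8, 0.9, 2.1, 2.2, 0.1` of the source are written `4/5, 9/10, 21/10,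
  11/5, 1/10`.

## References

* B. Rodgers, T. Tao, *The de Bruijn–Newman constant is non-negative*, Forum Math. Pi 8 (2020),
  e6; arXiv:1801.05914v5 (2021): §1.2, Thm. 4.1, Thm. 7.2, §8 (Prop. 8.1, Prop. 8.2 "Locating a
  good interval", Prop. 8.3 "Energy propagation inequality", and the footnote to Prop. 8.1
  acknowledging O. Zeitouni).
* G. Csordas, W. Smith, R. S. Varga, *Lehmer pairs of zeros, the de Bruijn–Newman constant `Λ`,
  and the Riemann Hypothesis*, Constr. Approx. 10 (1994), 107–129 (simplicity of the zeros,
  continuous dependence on `t`).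
-/

noncomputable section

open Real Filter Set MeasureTheory

namespace Literature.NumberTheory.LFunctions

/-! ## The dyadic boundary energy of Prop. 8.2 (v5) -/

/-- The dyadic scales of Prop. 8.2 (v5): the `n : ℕ` with `2ⁿ ≤ T log T / 10` ("`n` ranges over
natural numbers with `1 ≤ 2ⁿ ≤ 0.1 T log T`"), as a `Finset` (cut out of
`range (⌊T log T / 10⌋₊ + 1)`, which contains every such `n` since `n < 2ⁿ`).
[cite: RodgersTaoFMP2020, arXiv v5 Prop. 8.2] -/
def dyadicScales (T : ℝ) : Finset ℕ :=
  (Finset.range (⌊T * Real.log T / 10⌋₊ + 1)).filter fun n ↦ (2 : ℝ) ^ n ≤ T * Real.log T / 10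

/-- Membership in `dyadicScales T` is exactly `2ⁿ ≤ T log T / 10`. [folklore] -/
theorem mem_dyadicScales {T : ℝ} {n : ℕ} :
    n ∈ dyadicScales T ↔ (2 : ℝ) ^ n ≤ T * Real.log T / 10 := by
  rw [dyadicScales, Finset.mem_filter, Finset.mem_range, and_iff_right_iff_imp]
  intro h
  have hn : (n : ℝ) < (2 : ℝ) ^ n := by exact_mod_cast Nat.lt_two_pow_self
  have h0 : (0 : ℝ) ≤ T * Real.log T / 10 := le_trans (by positivity) h
  exact Nat.lt_succ_of_le (Nat.le_floor (hn.le.trans h))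

/-- Every dyadic scale satisfies `2ⁿ ≤ T log T / 10`. [folklore] -/
theorem two_pow_le_of_mem_dyadicScales {T : ℝ} {n : ℕ} (h : n ∈ dyadicScales T) :
    (2 : ℝ) ^ n ≤ T * Real.log T / 10 :=
  mem_dyadicScales.1 h

/-- The dyadic boundary energy of a pair of indices `I₁, I₂` (Rodgers–Tao, arXiv v5, Prop. 8.2):
`Σ_{n : 2ⁿ ≤ T log T/10} 2⁻ⁿ (Ẽ^{[I₁ − 2ⁿ, I₁ + 2ⁿ]}(t) + Ẽ^{[I₂ − 2ⁿ, I₂ + 2ⁿ]}(t))`, the windows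
being discrete intervals of natural numbers (`I_± ≥ 2ⁿ` in the source's range, so the truncated
subtraction is exact there). [cite: RodgersTaoFMP2020, arXiv v5 Prop. 8.2] -/
def boundaryEnergy (T : ℝ) (I₁ I₂ : ℕ) (t : ℝ) : ℝ :=
  ∑ n ∈ dyadicScales T, ((2 : ℝ) ^ n)⁻¹ *
    (renormEnergyOn t (Finset.Icc (I₁ - 2 ^ n) (I₁ + 2 ^ n)) +
      renormEnergyOn t (Finset.Icc (I₂ - 2 ^ n) (I₂ + 2 ^ n)))

/-- Unfolding lemma for `boundaryEnergy`. [folklore] -/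
theorem boundaryEnergy_eq (T : ℝ) (I₁ I₂ : ℕ) (t : ℝ) :
    boundaryEnergy T I₁ I₂ t = ∑ n ∈ dyadicScales T, ((2 : ℝ) ^ n)⁻¹ *
      (renormEnergyOn t (Finset.Icc (I₁ - 2 ^ n) (I₁ + 2 ^ n)) +
        renormEnergyOn t (Finset.Icc (I₂ - 2 ^ n) (I₂ + 2 ^ n))) := rfl

/-- "`I⁰ = [I₁, I₂]` is a good interval at level `B`" (the conclusion of Prop. 8.2 (v5) for the pair
`(I₁, I₂)`, with `Õ(1)` made explicit as `B` and `Λ/4` replaced by `t₀/4` for the witness `t₀`):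
the dyadic boundary energy `t ↦ boundaryEnergy T I₁ I₂ t` is integrable on `[t₀/4, 0]` and
`∫_{t₀/4}^0 boundaryEnergy T I₁ I₂ t dt ≤ B`. [cite: RodgersTaoFMP2020, arXiv v5 Prop. 8.2] -/
def IsGoodInterval (t₀ T : ℝ) (I₁ I₂ : ℕ) (B : ℝ) : Prop :=
  IntervalIntegrable (boundaryEnergy T I₁ I₂) volume (t₀ / 4) 0 ∧
    ∫ t in (t₀ / 4)..0, boundaryEnergy T I₁ I₂ t ≤ B

/-- Unfolding lemma for `IsGoodInterval`. [folklore] -/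
theorem isGoodInterval_iff (t₀ T : ℝ) (I₁ I₂ : ℕ) (B : ℝ) :
    IsGoodInterval t₀ T I₁ I₂ B ↔
      IntervalIntegrable (boundaryEnergy T I₁ I₂) volume (t₀ / 4) 0 ∧
        ∫ t in (t₀ / 4)..0, boundaryEnergy T I₁ I₂ t ≤ B := Iff.rfl

/-- A good interval at level `B` is good at every level `B' ≥ B`. [folklore] -/
theorem IsGoodInterval.mono {t₀ T : ℝ} {I₁ I₂ : ℕ} {B B' : ℝ} (h : IsGoodInterval t₀ T I₁ I₂ B)
    (hB : B ≤ B') : IsGoodInterval t₀ T I₁ I₂ B' :=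
  ⟨h.1, h.2.trans hB⟩

/-! ## The statements of Prop. 8.2 and Prop. 8.3 of arXiv v5, as predicates in the witness `t₀` -/

/-- HYPOTHESIS PREDICATE (the conclusion of Rodgers–Tao, arXiv v5 (2021), **Proposition 8.2**
(Locating a good interval), for the witness `t₀` of `Λ < 0`, in integer-endpoint form): there are
constants `A`, `C`, `T₀` such that for every `T ≥ T₀` there exist natural numbers
`I₁ ∈ [0.8 T log T, 0.9 T log T]` and `I₂ ∈ [2.1 T log T, 2.2 T log T]` (so that
`[I₁, I₂] ⊇ [0.9 T log T, 2.1 T log T]` and `⊆ [0.8 T log T, 2.2 T log T]`) with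
`∫_{t₀/4}^0 Σ_± Σ_{2ⁿ ≤ 0.1 T log T} 2⁻ⁿ Ẽ^{[I_± − 2ⁿ, I_± + 2ⁿ]}(t) dt ≤ C log^A T`, the integrand
being integrable (`IsGoodInterval`). In the source the endpoints are found by a continuous
pigeonholing and may be real; the integer-endpoint form is what the same argument gives when one
averages over integer endpoints. PROVED for every witness `t₀` from Thm. 7.2
(`rodgers_tao_integrated_energy_bound`) and the regularity of the zeros in
`RodgersTaoEnergyV5Proofs.lean` (`goodIntervalBound_of_integrated_energy_bound`).
[cite: RodgersTaoFMP2020, arXiv v5 Prop. 8.2] -/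
def GoodIntervalBound (t₀ : ℝ) : Prop :=
  ∃ A C T₀ : ℝ, ∀ T : ℝ, T₀ ≤ T →
    ∃ I₁ I₂ : ℕ, 4 / 5 * (T * Real.log T) ≤ I₁ ∧ (I₁ : ℝ) ≤ 9 / 10 * (T * Real.log T) ∧
      21 / 10 * (T * Real.log T) ≤ I₂ ∧ (I₂ : ℝ) ≤ 11 / 5 * (T * Real.log T) ∧
      IsGoodInterval t₀ T I₁ I₂ (C * Real.log T ^ A)

/-- HYPOTHESIS PREDICATE (the conclusion of Rodgers–Tao, arXiv v5 (2021), **Proposition 8.3**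
(Energy propagation inequality; proved there by Bourgain's pigeonholing argument from Lemma 4.2
(iii), (iv), Cor. 3.3, Lemma 7.1, Prop. 8.2 and Thm. 7.2), for the witness `t₀` of `Λ < 0`, i.e.
with `Λ/4` replaced by `t₀/4`). For all constants `A₀`, `C₀` of a good-interval bound there are
constants `A`, `C`, `T₀` such that for all `T ≥ T₀`: for all natural numbers
`I⁰₋ ∈ [0.8 T log T, 0.9 T log T]`, `I⁰₊ ∈ [2.1 T log T, 2.2 T log T]` with `[I⁰₋, I⁰₊]` good at
level `C₀ log^{A₀} T` on `[t₀/4, 0]` ("let `I⁰` be as in Proposition 8.2"), all real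
`I₁ ∈ [½ T log T, T log T]`, `I₂ ∈ [2T log T, 3T log T]` (so `I = [I₁, I₂] ⊇ [T log T, 2T log T]`
and `⊆ [½ T log T, 3T log T]`), and all `t₀/4 ≤ t₁ ≤ t₂ ≤ 0` with `t₂ ≤ t₁ + 1/(100 log² T)`:
`Ẽ^{I'}(t₂) ≤ Ẽ^{I}(t₁) + C log^A T · (1 + |I₁ − I⁰₋| + |I₂ − I⁰₊|)`,
`I' = [I₁ + log³ T, I₂ − log³ T]` ("`Õ(1 + |I₋ − I⁰₋| + |I₊ − I⁰₊|)`"). This is the corrected form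
of the propagation inequality, replacing `rodgers_tao_energy_propagation` (arXiv v1–4 Prop. 8.2,
whose printed proof was withdrawn in v5). The theorems of `RodgersTaoEnergyV5Proofs.lean` take
`(h : ∀ t₀ < 0, HasOnlyRealZeros (deBruijnH t₀) → EnergyPropagationV5 t₀)`.
[cite: RodgersTaoFMP2020, arXiv v5 Prop. 8.3] -/
def EnergyPropagationV5 (t₀ : ℝ) : Prop :=
  ∀ A₀ C₀ : ℝ, ∃ A C T₀ : ℝ, ∀ T : ℝ, T₀ ≤ T →
    ∀ J₁ J₂ : ℕ, 4 / 5 * (T * Real.log T) ≤ J₁ → (J₁ : ℝ) ≤ 9 / 10 * (T * Real.log T) →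
      21 / 10 * (T * Real.log T) ≤ J₂ → (J₂ : ℝ) ≤ 11 / 5 * (T * Real.log T) →
      IsGoodInterval t₀ T J₁ J₂ (C₀ * Real.log T ^ A₀) →
    ∀ I₁ I₂ : ℝ, T * Real.log T / 2 ≤ I₁ → I₁ ≤ T * Real.log T →
      2 * T * Real.log T ≤ I₂ → I₂ ≤ 3 * T * Real.log T →
    ∀ t₁ t₂ : ℝ, t₀ / 4 ≤ t₁ → t₁ ≤ t₂ → t₂ ≤ 0 → t₂ ≤ t₁ + 1 / (100 * Real.log T ^ 2) →
      renormEnergyOn t₂ (Finset.Icc ⌈I₁ + Real.log T ^ 3⌉₊ ⌊I₂ - Real.log T ^ 3⌋₊) ≤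
        renormEnergyOn t₁ (Finset.Icc ⌈I₁⌉₊ ⌊I₂⌋₊) +
          C * Real.log T ^ A * (1 + |I₁ - J₁| + |I₂ - J₂|)

/-! ## Elementary API: non-negativity and monotonicity of `Ẽ` for ordered zeros
continuity of `V` -/

/-- If the positive-index zeros at time `t` are strictly increasing, then `Ẽ_{jk}(t) ≥ 0` for
distinct positive indices (the argument of `V` is non-zero). [cite: RodgersTaoFMP2020, §7] -/
theorem renormEnergy_nonneg_of_strictMono {t : ℝ}
    (hmono : StrictMono fun j : ℕ ↦ deBruijnZero t (j + 1)) {j k : ℕ} (hj : 1 ≤ j) (hk : 1 ≤ k)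
    (hjk : j ≠ k) : 0 ≤ renormEnergy t j k := by
  obtain ⟨m₁, rfl⟩ : ∃ m, j = m + 1 := ⟨j - 1, by omega⟩
  obtain ⟨m₂, rfl⟩ : ∃ m, k = m + 1 := ⟨k - 1, by omega⟩
  have hne : m₁ ≠ m₂ := fun h ↦ hjk (by rw [h])
  rw [renormEnergy_eq]
  refine div_nonneg (renormPotential_nonneg (div_ne_zero ?_ ?_)) (sq_nonneg _)
  · exact sub_ne_zero.2 fun h ↦ hne.symm (hmono.injective h)
  · refine sub_ne_zero.2 fun h ↦ hjk ?_
    have h1 : ((m₂ + 1 : ℕ) : ℝ) ∈ Ici (-1 : ℝ) := by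
      simp only [mem_Ici]; exact le_trans (by norm_num) (Nat.cast_nonneg _)
    have h2 : ((m₁ + 1 : ℕ) : ℝ) ∈ Ici (-1 : ℝ) := by
      simp only [mem_Ici]; exact le_trans (by norm_num) (Nat.cast_nonneg _)
    exact_mod_cast (strictMonoOn_classicalLocation.injOn h1 h2 h).symm

/-- `Ẽ^I(t) ≥ 0` for a set `I` of positive indices when the zeros at time `t` are strictly
increasing ("this is clearly a non-negative quantity", §7). [cite: RodgersTaoFMP2020, §7] -/
theorem renormEnergyOn_nonneg_of_strictMono {t : ℝ}
    (hmono : StrictMono fun j : ℕ ↦ deBruijnZero t (j + 1)) {I : Finset ℕ} (hI : ∀ j ∈ I, 1 ≤ j) :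
    0 ≤ renormEnergyOn t I := by
  rw [renormEnergyOn_eq]
  refine Finset.sum_nonneg fun p hp ↦ ?_
  rw [Finset.mem_offDiag] at hp
  exact renormEnergy_nonneg_of_strictMono hmono (hI _ hp.1) (hI _ hp.2.1) hp.2.2

/-- Monotonicity of `Ẽ^I(t)` in `I` over positive indices when the zeros at time `t` are strictly
increasing ("non-decreasing in `I`", §7). [cite: RodgersTaoFMP2020, §7] -/
theorem renormEnergyOn_mono_of_strictMono {t : ℝ}
    (hmono : StrictMono fun j : ℕ ↦ deBruijnZero t (j + 1)) {I J : Finset ℕ} (hIJ : I ⊆ J)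
    (hJ : ∀ j ∈ J, 1 ≤ j) : renormEnergyOn t I ≤ renormEnergyOn t J := by
  rw [renormEnergyOn_eq, renormEnergyOn_eq]
  refine Finset.sum_le_sum_of_subset_of_nonneg (Finset.offDiag_mono hIJ) fun p hp _ ↦ ?_
  rw [Finset.mem_offDiag] at hp
  exact renormEnergy_nonneg_of_strictMono hmono (hJ _ hp.1) (hJ _ hp.2.1) hp.2.2

/-- The dyadic boundary energy is non-negative when the zeros at time `t` are strictly increasing
and the windows consist of positive indices (`1 + 2ⁿ ≤ I_±` for the scales involved).
[cite: RodgersTaoFMP2020, arXiv v5 Prop. 8.2] -/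
theorem boundaryEnergy_nonneg {T t : ℝ} {I₁ I₂ : ℕ}
    (hmono : StrictMono fun j : ℕ ↦ deBruijnZero t (j + 1))
    (h₁ : ∀ n ∈ dyadicScales T, 1 + 2 ^ n ≤ I₁) (h₂ : ∀ n ∈ dyadicScales T, 1 + 2 ^ n ≤ I₂) :
    0 ≤ boundaryEnergy T I₁ I₂ t := by
  rw [boundaryEnergy_eq]
  refine Finset.sum_nonneg fun n hn ↦ mul_nonneg (by positivity) (add_nonneg ?_ ?_)
  · refine renormEnergyOn_nonneg_of_strictMono hmono fun j hj ↦ ?_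
    rw [Finset.mem_Icc] at hj
    have := h₁ n hn
    omega
  · refine renormEnergyOn_nonneg_of_strictMono hmono fun j hj ↦ ?_
    rw [Finset.mem_Icc] at hj
    have := h₂ n hn
    omega

/-- `V` is continuous away from its junk point `0`. [folklore] -/
theorem continuousAt_renormPotential {x : ℝ} (hx : x ≠ 0) : ContinuousAt renormPotential x := by
  have h : renormPotential = fun y : ℝ ↦ 1 / y ^ 2 - 1 + 2 * (|y| - 1) := rfl
  rw [h]
  refine ((ContinuousAt.div continuousAt_const (continuousAt_id.pow 2) (pow_ne_zero 2 hx)).sub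
    continuousAt_const).add (continuousAt_const.mul (continuous_abs.continuousAt.sub
    continuousAt_const))

end Literature.NumberTheory.LFunctions

end
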